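import Literature.MathematicalPhysics.QuantumFieldTheory.Balaban1983to89.B1Eq324BenfattoSect5SlotMoments
import HarnessLib

/-!
# `Balaban1983to89.B1Eq324BenfattoSect5ChiToOneOnData` — [BenfattoEtAl1978] §5 (5.29) p. 158, FIRST TERM «the replacement of the
# χ's by 1» ON PRINT'S OBJECTS: tuple-class polynomial slots over `J ⊆ I` under `P̄(dz|z̄_Γ)` with small-field boundary data, the
# weight `χ = χ_b^□` (= 1 on the box small-field event), the tail from Appendix C Lemma 2 — NO analytic hypothesis left, PROVED

statement-level skeleton of published theorems with citation tags; proofs where landed; nothing here is a claim about the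
Yang–Mills mass gap

WHY THIS MODULE (cell `pub-ymgap`, seat `dag-n08-c`, node N08; sequel of `B1Eq324BenfattoSect5SlotMoments` §5–§6).  n08-b's
`B1Eq324BenfattoSect5ChiToOne.abs_ursellOf_moment_mul_sub_le_of_moments` is the generic (5.29) first term with two displayed inputs,
both named by Appendix D p. 165 (*"The replacement of the χ's by 1 is a trivial consequence of point 2) and Lemma 1 of Appendix C"*):
the MOMENT input «point 2)» (`hZm / hZint / hZL`) and the TAIL `P̄(χ ≠ 1) ≤ η^{2k}`.  `B1Eq324BenfattoSect5SlotMoments` discharged the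
first for polynomial slots (§6 there, abstract `χ`, `η`); this file inserts the second on print's objects: for `χ = 1` on the box event
`E = {z | ∀ x ∈ □, |z_x| < b(1 + d(Δ_x, I))}` (print's `χ_b^□`, (5.14)), Appendix C Lemma 2 in the tree
(`B1Eq324BenfattoAppendixCLemma2.appC_lemma2`: `P̄(E) ≥ 1 − 2|□|e^{−b²/4}`) gives `P̄(χ ≠ 1) ≤ τ := 2|□|e^{−b²/4}`, hence the
replacement bound with `η = (min 1 τ)^{1/(2k)}` — every analytic supplier a tree theorem, the remaining hypotheses being print's
kinematics (`E z_Δ² ≤ ½`, `b > 0`, `γ(1 + 2d/α²) ≤ ½`, data `|z̄_c| ≤ γb(1 + d(Δ_c, I))` on `Γ`, slots supported in `I`).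

WHAT IS PROVED (theorems only; no definition, no named fact, no `sorry`; axioms standard).
* `measureReal_ne_one_le_of_eq_one_on` — `P̄{χ ≠ 1} ≤ 2|□|e^{−b²/4}` for any weight equal to `1` on the box event (App. C Lemma 2).
* `measureReal_le_min_rpow_pow` — packaging `t ≤ τ`, `t ≤ 1` as `t ≤ ((min 1 τ)^{1/n})^n`.
* `abs_ursellOf_poly_mul_sub_le_of_smallFieldData` — the same bound for abstract `poly` slots with legs in `I` (degrees `≤ q`).
* ★★ **`abs_ursellOf_tupleSum_mul_sub_le_of_smallFieldData`** — (5.29) FIRST TERM ON PRINT'S OBJECTS: for `k = |σ|` tuple-class slots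
  `Z_j = Σ_pΣ_{Δ∈T_j p}Σ_n A^n_Δ e^{−(ϰ/2)d(Δ)} Π z_{Δᵢ}^{nᵢ}` over `J ⊆ I` (decay-weighted coefficient masses `≤ M`) and a measurable
  weight `0 ≤ χ ≤ 1` equal to `1` on `E`,
  `|𝓔^T_{z̄}(Z₁χ,…,Z_kχ) − 𝓔^T_{z̄}(Z₁,…,Z_k)| ≤ 2^k·(Σ_{π∈𝒫(k)}(|π|−1)!)·(min 1 (2|□|e^{−b²/4}))^{1/(2k)}·L^k`,
  `L = (1 + (1+2d/α²)γb)^D · M · momentConst D (2k) c₀`.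

HONEST SCOPE / NOT HERE.  AS PROVED vs AS PRINTED as in the two parents: rate `τ^{1/(2k)}` (print: `e^{−b²/4}` once, from the Gaussian
structure), constants `momentConst`/`(1+K)^D` (print: `s₄(s₂b^{D+2d}A)^k`).  The SECOND term of (5.29) (Appendix D proper, connected
diagrams, `e^{−ϰ̃b^{3/2}}`), (5.30)–(5.32) and the assembly are NOT here; `BasicLemmaPrinted` stays OPEN.  NOT summit progress;
count-neutral for N08; nothing of [Balaban1985UV3] is asserted.
-/

open Finset MeasureTheory
open scoped BigOperators NNReal Nat

namespace Literature.MathematicalPhysics.QuantumFieldTheory.Balaban1983to89.B1Eq324BenfattoSect5ChiToOneOnData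

open _root_.MeasureTheory _root_.ProbabilityTheory
open Literature.Probability.LatticeModels (setPartitions ursellOf)
open Literature.MathematicalPhysics.QuantumFieldTheory
open Literature.MathematicalPhysics.QuantumFieldTheory.Balaban1983to89.B1Eq324GaussianMomentLeaf (poly momentConst one_le_momentConst)
open Literature.MathematicalPhysics.QuantumFieldTheory.Balaban1983to89.B1Eq324BenfattoLemma
open Literature.MathematicalPhysics.QuantumFieldTheory.Balaban1983to89.B1Eq324BenfattoAppendixCLemma2 (appC_lemma2)
open Literature.MathematicalPhysics.QuantumFieldTheory.Balaban1983to89.B1Eq324BenfattoMarkov (isProbabilityMeasure_condField)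
open Literature.MathematicalPhysics.QuantumFieldTheory.Balaban1983to89.B1Eq324BenfattoSect5Cumulant (measurableSet_boxSmallField)
open Literature.MathematicalPhysics.QuantumFieldTheory.Balaban1983to89.B1Eq324BenfattoSect5Eq511 (term)
open Literature.MathematicalPhysics.QuantumFieldTheory.Balaban1983to89.B1Eq324BenfattoSect5ChiToOne
  (abs_ursellOf_moment_mul_sub_le_of_moments)
open Literature.MathematicalPhysics.QuantumFieldTheory.Balaban1983to89.B1Eq324BenfattoSect5SlotMoments
  (tupleSum_condField_moments_of_smallFieldData abs_ursellOf_poly_mul_sub_le abs_condMean_le_of_mem)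

variable {d : ℕ} {α β : ℝ}

/-- **THE TAIL OF `χ_b^□` (Appendix C Lemma 2 as `P̄(χ ≠ 1)`)**: for a weight `χ` equal to `1` on the box small-field event
`E = {z | ∀ x ∈ □, |z_x| < b(1 + d(Δ_x, I))}`, `P̄{χ ≠ 1} ≤ P̄(Eᶜ) ≤ 2|□|e^{−b²/4}` under the hypotheses of
`B1Eq324BenfattoAppendixCLemma2.appC_lemma2`. [cite: BenfattoEtAl1978, Appendix C Lemma 2 p.165 and (5.19) p.156] -/
theorem measureReal_ne_one_le_of_eq_one_on (hα : 0 < α) (hβ : 0 < β) (hvar : freeCov d α β 0 0 ≤ 1 / 2) {γ b : ℝ}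
    (hb : 0 < b) (hγ0 : 0 ≤ γ) (hγ : γ * (1 + 2 * d / α ^ 2) ≤ 1 / 2) (Γ I box : Finset (B1Eq324BenfattoLemma.Site d))
    (zbar : B1Eq324BenfattoLemma.Site d → ℝ) (hz : ∀ c ∈ Γ, |zbar c| ≤ γ * b * (1 + distToRegion I c))
    {χ : (B1Eq324BenfattoLemma.Site d → ℝ) → ℝ}
    (hχE : ∀ z : B1Eq324BenfattoLemma.Site d → ℝ, (∀ x ∈ box, |z x| < b * (1 + distToRegion I x)) → χ z = 1) :
    (condField d α β Γ zbar).real {z | χ z ≠ 1} ≤ 2 * (box.card : ℝ) * Real.exp (-(b ^ 2 / 4)) := by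
  haveI := isProbabilityMeasure_condField (d := d) hα hβ Γ zbar
  set E : Set (B1Eq324BenfattoLemma.Site d → ℝ) := {z | ∀ x ∈ box, |z x| < b * (1 + distToRegion I x)} with hE
  have hEm : MeasurableSet E := measurableSet_boxSmallField b I box
  have hsub : {z : B1Eq324BenfattoLemma.Site d → ℝ | χ z ≠ 1} ⊆ Eᶜ := fun z hz1 hzE => hz1 (hχE z hzE)
  have hL2 := appC_lemma2 hα hβ hvar hb hγ0 hγ Γ I box zbar hz
  calc (condField d α β Γ zbar).real {z | χ z ≠ 1} ≤ (condField d α β Γ zbar).real Eᶜ :=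
        measureReal_mono hsub (measure_ne_top _ _)
    _ = 1 - (condField d α β Γ zbar).real E := probReal_compl_eq_one_sub hEm
    _ ≤ 2 * (box.card : ℝ) * Real.exp (-(b ^ 2 / 4)) := by linarith

/-- Packaging a tail `t ≤ τ` with `0 ≤ t ≤ 1` as `t ≤ η^n` for `η = (min 1 τ)^{1/n} ∈ [0, 1]` (`n ≠ 0`). [folklore]
[cite: BenfattoEtAl1978, (5.29) p.158] -/
theorem measureReal_le_min_rpow_pow {t τ : ℝ} (ht0 : 0 ≤ t) (ht1 : t ≤ 1) (htτ : t ≤ τ) {n : ℕ} (hn : n ≠ 0) :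
    t ≤ ((min 1 τ) ^ ((n : ℝ)⁻¹)) ^ n ∧ 0 ≤ (min 1 τ) ^ ((n : ℝ)⁻¹) ∧ (min 1 τ) ^ ((n : ℝ)⁻¹) ≤ 1 := by
  have hm0 : 0 ≤ min 1 τ := le_min zero_le_one (ht0.trans htτ)
  refine ⟨?_, Real.rpow_nonneg hm0 _, ?_⟩
  · rw [Real.rpow_inv_natCast_pow hm0 hn]
    exact le_min ht1 htτ
  · exact Real.rpow_le_one hm0 (min_le_left _ _) (by positivity)

variable {s D : ℕ} {ϰ : ℝ} {a : Coef d} {Jr : Finset (B1Eq324BenfattoLemma.Site d)} {σ : Type*} [Fintype σ] [DecidableEq σ]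
  [Nonempty σ]

/-- **(5.29), FIRST TERM «χ → 1», ON PRINT'S OBJECTS — no analytic hypothesis left**: for `k = |σ|` tuple-class polynomial slots
`Z_j(z) = Σ_{p∈Icc 1 s} Σ_{Δ∈T_j p} Σ_{n∈admissible p D} A^n_Δ e^{−(ϰ/2)d(Δ)} Π z_{Δᵢ}^{nᵢ}` over `J ⊆ I` (decay-weighted coefficient masses
`𝓜_j ≤ M`), under `P̄ = condField d α β Γ z̄` with data `|z̄_c| ≤ γb(1 + d(Δ_c, I))` on `Γ` (`E z_Δ² = freeCov 0 0 ≤ ½`, `b > 0`,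
`γ(1 + 2d/α²) ≤ ½`), and a measurable weight `0 ≤ χ ≤ 1` equal to `1` on the box event `{∀ x ∈ □, |z_x| < b(1 + d(Δ_x, I))}` (print's
`χ_b^□`):
`|𝓔^T_{z̄}(Z₁χ,…,Z_kχ) − 𝓔^T_{z̄}(Z₁,…,Z_k)| ≤ 2^k·(Σ_{π∈𝒫(k)}(|π|−1)!)·(min 1 (2|□|e^{−b²/4}))^{1/(2k)}·L^k`,
`L = (1 + (1+2d/α²)γb)^D · M · momentConst D (2k) c₀` — n08-b's ChiToOne theorem with «point 2)» from
`B1Eq324BenfattoSect5SlotMoments.tupleSum_condField_moments_of_smallFieldData` and the tail from Appendix C Lemma 2.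
[cite: BenfattoEtAl1978, (5.29) p.157–158, Appendix D p.165, Appendix C Lemma 2 p.165] -/
theorem abs_ursellOf_tupleSum_mul_sub_le_of_smallFieldData (hα : 0 < α) (hβ : 0 < β) (hvar : freeCov d α β 0 0 ≤ 1 / 2)
    {γ b : ℝ} (hb : 0 < b) (hγ0 : 0 ≤ γ) (hγ : γ * (1 + 2 * d / α ^ 2) ≤ 1 / 2)
    (Γ I box : Finset (B1Eq324BenfattoLemma.Site d)) (zbar : B1Eq324BenfattoLemma.Site d → ℝ)
    (hz : ∀ c ∈ Γ, |zbar c| ≤ γ * b * (1 + distToRegion I c)) (hJI : Jr ⊆ I)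
    (T : σ → (p : ℕ) → Finset (Fin p → Jr)) {M : ℝ}
    (hM : ∀ j, ∑ p ∈ Finset.Icc 1 s, ∑ Δ ∈ T j p, ∑ n ∈ admissible p D,
        |a p (fun i => (Δ i : B1Eq324BenfattoLemma.Site d)) n| *
          Real.exp (-(ϰ / 2) * connLength fun i => (Δ i : B1Eq324BenfattoLemma.Site d)) ≤ M)
    {χ : (B1Eq324BenfattoLemma.Site d → ℝ) → ℝ} (hχm : Measurable χ) (hχ0 : ∀ z, 0 ≤ χ z) (hχ1 : ∀ z, χ z ≤ 1)
    (hχE : ∀ z : B1Eq324BenfattoLemma.Site d → ℝ, (∀ x ∈ box, |z x| < b * (1 + distToRegion I x)) → χ z = 1) :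
    |ursellOf (fun P : Finset σ => ∫ z, ∏ j ∈ P,
          (∑ p ∈ Finset.Icc 1 s, ∑ Δ ∈ T j p, ∑ n ∈ admissible p D, term ϰ a z p Δ n) * χ z ∂condField d α β Γ zbar)
        Finset.univ -
      ursellOf (fun P : Finset σ => ∫ z, ∏ j ∈ P,
          (∑ p ∈ Finset.Icc 1 s, ∑ Δ ∈ T j p, ∑ n ∈ admissible p D, term ϰ a z p Δ n) ∂condField d α β Γ zbar)
        Finset.univ| ≤
      2 ^ Fintype.card σ * ((∑ π ∈ setPartitions (Finset.univ : Finset σ), ((π.card - 1)! : ℝ)) *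
        ((min 1 (2 * (box.card : ℝ) * Real.exp (-(b ^ 2 / 4)))) ^ ((2 * Fintype.card σ : ℕ) : ℝ)⁻¹ *
          ((1 + (1 + 2 * d / α ^ 2) * (γ * b)) ^ D * M * momentConst D (2 * Fintype.card σ) (freeCov d α β 0 0).toNNReal) ^
            Fintype.card σ)) := by
  haveI := isProbabilityMeasure_condField (d := d) hα hβ Γ zbar
  set c₀ := (freeCov d α β 0 0).toNNReal with hc₀
  set Kf := (1 + (1 + 2 * d / α ^ 2) * (γ * b)) ^ D with hKf
  have hγb : 0 ≤ γ * b := mul_nonneg hγ0 hb.le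
  have hKf0 : 0 ≤ Kf := pow_nonneg (by positivity) _
  have hmc : 1 ≤ momentConst D (2 * Fintype.card σ) c₀ := one_le_momentConst _ _ _
  have hM0 : 0 ≤ M := (Finset.sum_nonneg fun p _ => Finset.sum_nonneg fun Δ _ => Finset.sum_nonneg fun n _ =>
    mul_nonneg (abs_nonneg _) (Real.exp_pos _).le).trans (hM (Classical.arbitrary σ))
  have hk : (2 * Fintype.card σ : ℕ) ≠ 0 := by
    have := Fintype.card_pos (α := σ)
    omega
  have hpk := fun j => tupleSum_condField_moments_of_smallFieldData (s := s) (D := D) (ϰ := ϰ) (a := a) hα hβ hγb Γ I zbar hz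
    hJI (T j) (2 * Fintype.card σ)
  have ht1 : (condField d α β Γ zbar).real {z | χ z ≠ 1} ≤ 1 := measureReal_le_one
  obtain ⟨htail, hη0, hη1⟩ := measureReal_le_min_rpow_pow measureReal_nonneg ht1
    (measureReal_ne_one_le_of_eq_one_on hα hβ hvar hb hγ0 hγ Γ I box zbar hz hχE) hk
  refine abs_ursellOf_moment_mul_sub_le_of_moments (μ := condField d α β Γ zbar)
    (Z := fun j z => ∑ p ∈ Finset.Icc 1 s, ∑ Δ ∈ T j p, ∑ n ∈ admissible p D, term ϰ a z p Δ n)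
    (fun j => (hpk j).1) (fun j p _ => (hpk j).2.1 p) (fun j p hp => ((hpk j).2.2 p hp).trans ?_) hχm hχ0 hχ1
    (mul_nonneg (mul_nonneg hKf0 hM0) (zero_le_one.trans hmc)) hη0 hη1 htail
  exact pow_le_pow_left₀ (mul_nonneg (mul_nonneg hKf0 (Finset.sum_nonneg fun p _ => Finset.sum_nonneg fun Δ _ =>
    Finset.sum_nonneg fun n _ => mul_nonneg (abs_nonneg _) (Real.exp_pos _).le)) (zero_le_one.trans hmc))
    (mul_le_mul_of_nonneg_right (mul_le_mul_of_nonneg_left (hM j) hKf0) (zero_le_one.trans hmc)) p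

/-- **The same for abstract polynomial slots** `Z_j = Σ_{i∈I_j} a_{ji} Π_{l∈J_{ji}} z(x_{jil})` with all legs in `I` (degrees `≤ q`,
coefficient masses `≤ M`): `|𝓔^T_{z̄}(Z₁χ,…,Z_kχ) − 𝓔^T_{z̄}(Z₁,…,Z_k)| ≤ 2^k(Σ_π(|π|−1)!)·(min 1 (2|□|e^{−b²/4}))^{1/(2k)}·L^k`,
`L = (1 + (1+2d/α²)γb)^q · M · momentConst q (2k) c₀` (`B1Eq324BenfattoSect5SlotMoments.abs_ursellOf_poly_mul_sub_le` + (C.8) on `I` +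
App. C Lemma 2). [cite: BenfattoEtAl1978, (5.29) p.157–158, Appendix D p.165, Appendix C Lemma 2 p.165] -/
theorem abs_ursellOf_poly_mul_sub_le_of_smallFieldData {ι κ : Type*} [DecidableEq κ] (hα : 0 < α) (hβ : 0 < β)
    (hvar : freeCov d α β 0 0 ≤ 1 / 2) {γ b : ℝ} (hb : 0 < b) (hγ0 : 0 ≤ γ) (hγ : γ * (1 + 2 * d / α ^ 2) ≤ 1 / 2)
    (Γ I box : Finset (B1Eq324BenfattoLemma.Site d)) (zbar : B1Eq324BenfattoLemma.Site d → ℝ)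
    (hz : ∀ c ∈ Γ, |zbar c| ≤ γ * b * (1 + distToRegion I c))
    (Is : σ → Finset ι) (J : σ → ι → Finset κ) (av : σ → ι → ℝ) (x : σ → ι → κ → B1Eq324BenfattoLemma.Site d)
    (hxI : ∀ j, ∀ i ∈ Is j, ∀ l ∈ J j i, x j i l ∈ I) {q : ℕ} (hq : ∀ j, ∀ i ∈ Is j, (J j i).card ≤ q) {M : ℝ}
    (hM : ∀ j, ∑ i ∈ Is j, |av j i| ≤ M)
    {χ : (B1Eq324BenfattoLemma.Site d → ℝ) → ℝ} (hχm : Measurable χ) (hχ0 : ∀ z, 0 ≤ χ z) (hχ1 : ∀ z, χ z ≤ 1)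
    (hχE : ∀ z : B1Eq324BenfattoLemma.Site d → ℝ, (∀ x ∈ box, |z x| < b * (1 + distToRegion I x)) → χ z = 1) :
    |ursellOf (fun P : Finset σ => ∫ z, ∏ j ∈ P,
          poly (Is j) (J j) (av j) (fun i l (z : B1Eq324BenfattoLemma.Site d → ℝ) => z (x j i l)) z * χ z ∂condField d α β Γ zbar)
        Finset.univ -
      ursellOf (fun P : Finset σ => ∫ z, ∏ j ∈ P,
          poly (Is j) (J j) (av j) (fun i l (z : B1Eq324BenfattoLemma.Site d → ℝ) => z (x j i l)) z ∂condField d α β Γ zbar)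
        Finset.univ| ≤
      2 ^ Fintype.card σ * ((∑ π ∈ setPartitions (Finset.univ : Finset σ), ((π.card - 1)! : ℝ)) *
        ((min 1 (2 * (box.card : ℝ) * Real.exp (-(b ^ 2 / 4)))) ^ ((2 * Fintype.card σ : ℕ) : ℝ)⁻¹ *
          ((1 + (1 + 2 * d / α ^ 2) * (γ * b)) ^ q * M * momentConst q (2 * Fintype.card σ) (freeCov d α β 0 0).toNNReal) ^
            Fintype.card σ)) := by
  haveI := isProbabilityMeasure_condField (d := d) hα hβ Γ zbar
  have hγb : 0 ≤ γ * b := mul_nonneg hγ0 hb.le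
  have hk : (2 * Fintype.card σ : ℕ) ≠ 0 := by
    have := Fintype.card_pos (α := σ)
    omega
  have ht1 : (condField d α β Γ zbar).real {z | χ z ≠ 1} ≤ 1 := measureReal_le_one
  obtain ⟨htail, hη0, hη1⟩ := measureReal_le_min_rpow_pow measureReal_nonneg ht1
    (measureReal_ne_one_le_of_eq_one_on hα hβ hvar hb hγ0 hγ Γ I box zbar hz hχE) hk
  exact abs_ursellOf_poly_mul_sub_le hα hβ Γ zbar Is J av x (mul_nonneg (by positivity) hγb)
    (fun j i hi l hl => abs_condMean_le_of_mem hα hβ hγb Γ I zbar hz (hxI j i hi l hl)) hq hM hχm hχ0 hχ1 hη0 hη1 htail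

end Literature.MathematicalPhysics.QuantumFieldTheory.Balaban1983to89.B1Eq324BenfattoSect5ChiToOneOnData
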